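import Summits.HubbardSuperconductivity.HubbardSuperconductivity.Theorems.SoloBlindCertificateFromGroundGap
import HarnessLib

/-!
# Requirement "every ground state" under essential uniqueness: Schur transfer

The summit asks for d-wave order in EVERY ground state of the doped sector (requirement R4 of the
seat's obstruction report). This file proves the reduction of R4 to ESSENTIAL UNIQUENESS: if the
ground eigenspace `V_L` of the sector is IRREDUCIBLE under some family `G` of symmetries (matrices
mapping ground states to ground states, together with their adjoints) that commute with the order
observable `O = (√2Δ_d)†(√2Δ_d)`, then `⟨φ, O ψ⟩ = μ ⟨φ, ψ⟩` on `V_L` (Schur's lemma for the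
compression `P_V O P_V`), so d-wave order `≥ cL⁴` in ONE unit ground state is d-wave order
`≥ cL⁴‖ψ‖²` in ALL of them, and the finite-volume criterion (`SoloBlindFiniteVolumeCriterion`)
gives the summit.

* `exists_weak_eigenvector_compression` — the compression of any matrix `O` to a subspace
  `V ≠ ⊥` has an eigenvector in weak form: `w ∈ V`, `w ≠ 0`, `⟨φ, O w⟩ = μ⟨φ, w⟩` for `φ ∈ V`
  (transport to `EuclideanSpace`, `Module.End.exists_eigenvalue` for `P_V O|_V`).
* `dotProduct_eq_scalar_of_irreducible` — SCHUR: `O` commutes with every `g ∈ G`, `V` is stable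
  under `g` and `gᴴ`, and `V` has no `G`-stable subspace other than `⊥` and `V` `⟹`
  `∃ μ, ∀ φ ψ ∈ V, ⟨φ, Oψ⟩ = μ⟨φ, ψ⟩`.
* `groundState_order_of_irreducible` — hence a bound `a ≤ re⟨ψ₀, Oψ₀⟩` for ONE unit vector of an
  irreducible `V` is the bound `a‖ψ‖² ≤ re⟨ψ, Oψ⟩` on all of `V`.
* `hubbardSuperconductivity_of_irreducible_groundSpaces` — THE SUMMIT follows from: for some
  `U > 0`, `δ ∈ (0,1/2)`, `c > 0` and every large even `L`, (i) a family `G_L` of matrices commuting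
  with `Δ_d†Δ_d` and mapping sector ground states to sector ground states (or `0`), adjoints
  included, under which the ground eigenspace is irreducible (ESSENTIAL UNIQUENESS), and (ii) ONE
  unit sector ground state with `re⟨ψ, Δ_d†Δ_dψ⟩ ≥ cL⁴`.

Reading. (i) is the natural home of lattice translations, the point group and spin rotations
(all commute with `H` and with the `s`-symmetric scalar `Δ_d†Δ_d`); it says the sector ground
state is unique up to symmetry — open for the doped Hubbard model at every `U > 0` (at half
filling it is Lieb's theorem). Perturbative / variational constructions address (ii) for one
state; (i) is what they leave out. References: Schur's lemma (Serre, *Linear Representations of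
Finite Groups*, §2.2); Lieb (1989) for half filling.
-/

namespace Summit.HubbardSuperconductivity.HubbardSuperconductivity.Theorems

open Matrix Finset Literature.MathematicalPhysics.QuantumLattice
  Literature.MathematicalPhysics.QuantumFieldTheory GaugeTwist WithLp
open scoped ComplexConjugate ComplexOrder InnerProductSpace

section Abstract

variable {n : Type*} [Fintype n]

/-- **An eigenvector of the compression.** For any matrix `O` and subspace `V ≠ ⊥` there are
`μ ∈ ℂ` and `w ∈ V`, `w ≠ 0`, with `⟨φ, O w⟩ = μ ⟨φ, w⟩` for all `φ ∈ V` (i.e. `P_V O w = μ w`).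
[folklore] -/
theorem exists_weak_eigenvector_compression (O : Matrix n n ℂ) (V : Submodule ℂ (n → ℂ))
    (hV : V ≠ ⊥) :
    ∃ μ : ℂ, ∃ w ∈ V, w ≠ 0 ∧ ∀ φ ∈ V, star φ ⬝ᵥ (O *ᵥ w) = μ * (star φ ⬝ᵥ w) := by
  let V' : Submodule ℂ (EuclideanSpace ℂ n) :=
    { carrier := {x | ofLp x ∈ V}
      zero_mem' := by simp
      add_mem' := fun {x y} hx hy => by
        simp only [Set.mem_setOf_eq] at hx hy ⊢
        rw [ofLp_add]; exact V.add_mem hx hy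
      smul_mem' := fun c {x} hx => by
        simp only [Set.mem_setOf_eq] at hx ⊢
        rw [ofLp_smul]; exact V.smul_mem c hx }
  have hmem : ∀ y, y ∈ V' ↔ ofLp y ∈ V := fun _ => Iff.rfl
  let f : EuclideanSpace ℂ n →ₗ[ℂ] EuclideanSpace ℂ n :=
    { toFun := fun x => toLp 2 (O *ᵥ ofLp x)
      map_add' := fun x y => by rw [ofLp_add, mulVec_add, toLp_add]
      map_smul' := fun c x => by rw [ofLp_smul, mulVec_smul, toLp_smul, RingHom.id_apply] }
  have hf : ∀ x, f x = toLp 2 (O *ᵥ ofLp x) := fun _ => rfl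
  let P : EuclideanSpace ℂ n →ₗ[ℂ] EuclideanSpace ℂ n :=
    (V'.starProjection : EuclideanSpace ℂ n →L[ℂ] EuclideanSpace ℂ n).toLinearMap
  have hP : ∀ x, P x = V'.starProjection x := fun _ => rfl
  have hmaps : ∀ x ∈ V', (P ∘ₗ f) x ∈ V' := fun x _ => by
    rw [LinearMap.comp_apply, hP]; exact V'.starProjection_apply_mem _
  obtain ⟨v, hvV, hv0⟩ := Submodule.exists_mem_ne_zero_of_ne_bot hV
  haveI : Nontrivial V' := by
    refine Submodule.nontrivial_iff_ne_bot.2 (Submodule.ne_bot_iff _ |>.2 ⟨toLp 2 v, ?_, ?_⟩)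
    · rw [hmem, ofLp_toLp]; exact hvV
    · intro h
      apply hv0
      calc v = ofLp (toLp 2 v : EuclideanSpace ℂ n) := rfl
        _ = 0 := by rw [h, ofLp_zero]
  obtain ⟨μ, hμ⟩ := Module.End.exists_eigenvalue ((P ∘ₗ f).restrict hmaps)
  obtain ⟨x, hx⟩ := hμ.exists_hasEigenvector
  have hx0 : (x : EuclideanSpace ℂ n) ≠ 0 := fun h =>
    (Module.End.hasEigenvector_iff.mp hx).2 (Subtype.ext h)
  have hPfx : V'.starProjection (f x) = μ • (x : EuclideanSpace ℂ n) := by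
    have h := congrArg Subtype.val hx.apply_eq_smul
    rw [LinearMap.restrict_apply, Submodule.coe_smul] at h
    exact h
  refine ⟨μ, ofLp (x : EuclideanSpace ℂ n), x.2, fun h => hx0 ?_, fun φ hφ => ?_⟩
  · calc (x : EuclideanSpace ℂ n) = toLp 2 (ofLp (x : EuclideanSpace ℂ n)) := rfl
      _ = 0 := by rw [h, toLp_zero]
  · have hφ' : (toLp 2 φ : EuclideanSpace ℂ n) ∈ V' := by rw [hmem, ofLp_toLp]; exact hφ
    have key : ⟪(toLp 2 φ : EuclideanSpace ℂ n), f x⟫_ℂ =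
        μ * ⟪(toLp 2 φ : EuclideanSpace ℂ n), (x : EuclideanSpace ℂ n)⟫_ℂ :=
      calc ⟪(toLp 2 φ : EuclideanSpace ℂ n), f x⟫_ℂ
          = ⟪V'.starProjection (toLp 2 φ), f x⟫_ℂ := by
            rw [Submodule.starProjection_eq_self_iff.mpr hφ']
        _ = ⟪(toLp 2 φ : EuclideanSpace ℂ n), V'.starProjection (f x)⟫_ℂ :=
            Submodule.inner_starProjection_left_eq_right V' _ _
        _ = μ * ⟪(toLp 2 φ : EuclideanSpace ℂ n), (x : EuclideanSpace ℂ n)⟫_ℂ := by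
            rw [hPfx, inner_smul_right]
    rw [EuclideanSpace.inner_eq_star_dotProduct, EuclideanSpace.inner_eq_star_dotProduct,
      ofLp_toLp, hf, ofLp_toLp, dotProduct_comm (O *ᵥ _) (star φ),
      dotProduct_comm (ofLp _) (star φ)] at key
    exact key

/-- **Schur's lemma for a compression** (`dotProduct` form). If `O` commutes with every `g ∈ G`,
the subspace `V` is stable under each `g` and each `gᴴ`, and `V` has no `G`-stable subspace other
than `⊥` and `V`, then `⟨φ, Oψ⟩ = μ⟨φ, ψ⟩` for all `φ, ψ ∈ V`, for one scalar `μ`. (The weak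
eigenspace of the compression inside `V` is `G`-stable and nonzero.) Serre §2.2. [folklore] -/
theorem dotProduct_eq_scalar_of_irreducible (O : Matrix n n ℂ) (G : Set (Matrix n n ℂ))
    (V : Submodule ℂ (n → ℂ)) (hO : ∀ g ∈ G, O * g = g * O)
    (hV : ∀ g ∈ G, ∀ v ∈ V, g *ᵥ v ∈ V) (hVH : ∀ g ∈ G, ∀ v ∈ V, gᴴ *ᵥ v ∈ V)
    (hirr : ∀ W : Submodule ℂ (n → ℂ), W ≤ V → (∀ g ∈ G, ∀ w ∈ W, g *ᵥ w ∈ W) →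
      W = ⊥ ∨ W = V) :
    ∃ μ : ℂ, ∀ φ ∈ V, ∀ ψ ∈ V, star φ ⬝ᵥ (O *ᵥ ψ) = μ * (star φ ⬝ᵥ ψ) := by
  by_cases hbot : V = ⊥
  · refine ⟨0, fun φ _ ψ hψ => ?_⟩
    rw [hbot, Submodule.mem_bot] at hψ
    subst hψ
    simp
  obtain ⟨μ, w, hwV, hw0, hw⟩ := exists_weak_eigenvector_compression O V hbot
  let W : Submodule ℂ (n → ℂ) :=
    { carrier := {u | u ∈ V ∧ ∀ φ ∈ V, star φ ⬝ᵥ (O *ᵥ u) = μ * (star φ ⬝ᵥ u)}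
      zero_mem' := ⟨V.zero_mem, fun φ _ => by simp⟩
      add_mem' := by
        rintro x y ⟨hxV, hx⟩ ⟨hyV, hy⟩
        exact ⟨V.add_mem hxV hyV, fun φ hφ => by
          rw [mulVec_add, dotProduct_add, hx φ hφ, hy φ hφ, dotProduct_add, mul_add]⟩
      smul_mem' := by
        rintro c x ⟨hxV, hx⟩
        exact ⟨V.smul_mem c hxV, fun φ hφ => by
          rw [mulVec_smul, dotProduct_smul, hx φ hφ, dotProduct_smul, smul_eq_mul, smul_eq_mul,
            mul_left_comm]⟩ }
  have hmem : ∀ u, u ∈ W ↔ u ∈ V ∧ ∀ φ ∈ V, star φ ⬝ᵥ (O *ᵥ u) = μ * (star φ ⬝ᵥ u) :=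
    fun _ => Iff.rfl
  have hWV : W ≤ V := fun u hu => ((hmem u).1 hu).1
  have hadj : ∀ g : Matrix n n ℂ, ∀ φ y : n → ℂ,
      star φ ⬝ᵥ (g *ᵥ y) = star (gᴴ *ᵥ φ) ⬝ᵥ y := fun g φ y => by
    rw [dotProduct_mulVec, star_mulVec, conjTranspose_conjTranspose]
  have hWinv : ∀ g ∈ G, ∀ u ∈ W, g *ᵥ u ∈ W := by
    intro g hg u hu
    rw [hmem] at hu ⊢
    refine ⟨hV g hg u hu.1, fun φ hφ => ?_⟩
    rw [mulVec_mulVec, hO g hg, ← mulVec_mulVec, hadj, hu.2 _ (hVH g hg φ hφ), hadj]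
  rcases hirr W hWV hWinv with h | h
  · have hwW : w ∈ W := (hmem w).2 ⟨hwV, hw⟩
    rw [h, Submodule.mem_bot] at hwW
    exact absurd hwW hw0
  · refine ⟨μ, fun φ hφ ψ hψ => ?_⟩
    have hψW : ψ ∈ W := by rw [h]; exact hψ
    exact ((hmem ψ).1 hψW).2 φ hφ

/-- **One ground state suffices under essential uniqueness.** Let `V = {v ∈ S | Hv = E₀v}` be
stable under each `g ∈ G` and each `gᴴ`, irreducible under `G`, and let `O` commute with `G`. If
ONE unit vector `ψ₀ ∈ V` has `a ≤ re⟨ψ₀, Oψ₀⟩`, then `a‖φ‖² ≤ re⟨φ, Oφ⟩` for EVERY `φ ∈ V`.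
[this work] -/
theorem groundState_order_of_irreducible (H O : Matrix n n ℂ) (S : Submodule ℂ (n → ℂ))
    (E₀ a : ℝ) (G : Set (Matrix n n ℂ)) (hO : ∀ g ∈ G, O * g = g * O)
    (hG : ∀ g ∈ G, ∀ v ∈ S, H *ᵥ v = (E₀ : ℂ) • v →
      (g *ᵥ v ∈ S ∧ H *ᵥ (g *ᵥ v) = (E₀ : ℂ) • (g *ᵥ v)) ∧
        (gᴴ *ᵥ v ∈ S ∧ H *ᵥ (gᴴ *ᵥ v) = (E₀ : ℂ) • (gᴴ *ᵥ v)))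
    (hirr : ∀ W : Submodule ℂ (n → ℂ), (∀ w ∈ W, w ∈ S ∧ H *ᵥ w = (E₀ : ℂ) • w) →
      (∀ g ∈ G, ∀ w ∈ W, g *ᵥ w ∈ W) → W = ⊥ ∨ ∀ v ∈ S, H *ᵥ v = (E₀ : ℂ) • v → v ∈ W)
    (hone : ∃ ψ ∈ S, H *ᵥ ψ = (E₀ : ℂ) • ψ ∧ star ψ ⬝ᵥ ψ = 1 ∧ a ≤ (star ψ ⬝ᵥ (O *ᵥ ψ)).re) :
    ∀ φ ∈ S, H *ᵥ φ = (E₀ : ℂ) • φ → a * (star φ ⬝ᵥ φ).re ≤ (star φ ⬝ᵥ (O *ᵥ φ)).re := by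
  let V : Submodule ℂ (n → ℂ) :=
    { carrier := {v | v ∈ S ∧ H *ᵥ v = (E₀ : ℂ) • v}
      zero_mem' := by simp
      add_mem' := by
        rintro x y ⟨hxS, hx⟩ ⟨hyS, hy⟩
        exact ⟨S.add_mem hxS hyS, by rw [mulVec_add, hx, hy, smul_add]⟩
      smul_mem' := by
        rintro c x ⟨hxS, hx⟩
        exact ⟨S.smul_mem c hxS, by rw [mulVec_smul, hx, smul_comm]⟩ }
  have hmem : ∀ v, v ∈ V ↔ v ∈ S ∧ H *ᵥ v = (E₀ : ℂ) • v := fun _ => Iff.rfl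
  obtain ⟨μ, hμ⟩ := dotProduct_eq_scalar_of_irreducible O G V hO
    (fun g hg v hv => (hmem _).2 ((hG g hg v ((hmem v).1 hv).1 ((hmem v).1 hv).2).1))
    (fun g hg v hv => (hmem _).2 ((hG g hg v ((hmem v).1 hv).1 ((hmem v).1 hv).2).2))
    (fun W hWV hWinv => (hirr W (fun w hw => (hmem w).1 (hWV hw)) hWinv).imp_right
      fun h => le_antisymm hWV fun v hv => h v ((hmem v).1 hv).1 ((hmem v).1 hv).2)
  obtain ⟨ψ, hψS, hψ, hψ1, hψa⟩ := hone
  have hμa : a ≤ μ.re := by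
    have h := hμ ψ ((hmem ψ).2 ⟨hψS, hψ⟩) ψ ((hmem ψ).2 ⟨hψS, hψ⟩)
    rw [hψ1, mul_one] at h
    rwa [h] at hψa
  intro φ hφS hφ
  have hφV : φ ∈ V := (hmem φ).2 ⟨hφS, hφ⟩
  have hnn := Complex.nonneg_iff.mp (dotProduct_star_self_nonneg φ)
  rw [hμ φ hφV φ hφV, Complex.mul_re, ← hnn.2, mul_zero, sub_zero]
  exact mul_le_mul_of_nonneg_right hμa hnn.1

end Abstract

/-! ### The summit under essential uniqueness -/

/-- **Essential uniqueness + one good ground state ⟹ `HubbardSuperconductivity`.** Suppose that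
for some `U > 0`, `δ ∈ (0,1/2)`, `c > 0`, `L₀` and every even side `L = n+1 ≥ L₀` — with
`H = hubbardTorus 2 L 1 U`, sector `(2⌊(1-δ)L²/2⌋, S^z = 0)` and its ground states in the sense of
`IsGroundStateInSector` — there is a set `G` of matrices on Fock space such that (a) each `g ∈ G`
commutes with `(√2Δ_d)†(√2Δ_d)`; (b) each `g ∈ G` and its adjoint map sector ground states to
sector ground states or to `0`; (c) IRREDUCIBILITY: every `G`-stable subspace consisting of
sector ground states (and `0`) is `⊥` or contains all sector ground states; and (d) ONE unit
sector ground state has `re⟨ψ, (√2Δ_d)†(√2Δ_d)ψ⟩ ≥ cL⁴`. Then `HubbardSuperconductivity`.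
[this work] -/
theorem hubbardSuperconductivity_of_irreducible_groundSpaces
    (h : ∃ U : ℝ, 0 < U ∧ ∃ δ ∈ Set.Ioo (0 : ℝ) (1 / 2), ∃ c : ℝ, 0 < c ∧ ∃ L₀ : ℕ,
      ∀ n : ℕ, Even (n + 1) → L₀ ≤ n + 1 →
        ∃ G : Set (Matrix (Finset (Orb (FermionTorus 2 (n + 1))))
            (Finset (Orb (FermionTorus 2 (n + 1)))) ℂ),
          (∀ g ∈ G, (pairField dWaveFormFactor (n + 1))ᴴ * pairField dWaveFormFactor (n + 1) * g
            = g * ((pairField dWaveFormFactor (n + 1))ᴴ * pairField dWaveFormFactor (n + 1))) ∧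
          (∀ g ∈ G, ∀ ψ, IsGroundStateInSector (hubbardTorus 2 (n + 1) 1 U)
              (2 * ⌊(1 - δ) * ((n + 1 : ℕ) : ℝ) ^ 2 / 2⌋₊) 0 ψ →
            (g *ᵥ ψ = 0 ∨ IsGroundStateInSector (hubbardTorus 2 (n + 1) 1 U)
              (2 * ⌊(1 - δ) * ((n + 1 : ℕ) : ℝ) ^ 2 / 2⌋₊) 0 (g *ᵥ ψ)) ∧
            (gᴴ *ᵥ ψ = 0 ∨ IsGroundStateInSector (hubbardTorus 2 (n + 1) 1 U)
              (2 * ⌊(1 - δ) * ((n + 1 : ℕ) : ℝ) ^ 2 / 2⌋₊) 0 (gᴴ *ᵥ ψ))) ∧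
          (∀ W : Submodule ℂ (Fock (Orb (FermionTorus 2 (n + 1)))),
            (∀ w ∈ W, w = 0 ∨ IsGroundStateInSector (hubbardTorus 2 (n + 1) 1 U)
              (2 * ⌊(1 - δ) * ((n + 1 : ℕ) : ℝ) ^ 2 / 2⌋₊) 0 w) →
            (∀ g ∈ G, ∀ w ∈ W, g *ᵥ w ∈ W) →
            W = ⊥ ∨ ∀ ψ, IsGroundStateInSector (hubbardTorus 2 (n + 1) 1 U)
              (2 * ⌊(1 - δ) * ((n + 1 : ℕ) : ℝ) ^ 2 / 2⌋₊) 0 ψ → ψ ∈ W) ∧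
          (∃ ψ, IsGroundStateInSector (hubbardTorus 2 (n + 1) 1 U)
              (2 * ⌊(1 - δ) * ((n + 1 : ℕ) : ℝ) ^ 2 / 2⌋₊) 0 ψ ∧ star ψ ⬝ᵥ ψ = 1 ∧
            c * ((n + 1 : ℕ) : ℝ) ^ 4 ≤ (expect
              ((pairField dWaveFormFactor (n + 1))ᴴ * pairField dWaveFormFactor (n + 1)) ψ).re)) :
    HubbardSuperconductivity := by
  obtain ⟨U, hU, δ, hδ, c, hc, L₀, hb⟩ := h
  refine hubbardSuperconductivity_of_uniform_dWave_bound
    ⟨U, hU, δ, hδ, c, hc, L₀, fun n hn hL φ hφ1 hgs => ?_⟩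
  obtain ⟨G, hO, hG, hirr, ψ, hψ, hψ1, hψc⟩ := hb n hn hL
  set H := hubbardTorus 2 (n + 1) 1 U
  set N : ℕ := 2 * ⌊(1 - δ) * ((n + 1 : ℕ) : ℝ) ^ 2 / 2⌋₊
  set O := (pairField dWaveFormFactor (n + 1))ᴴ * pairField dWaveFormFactor (n + 1)
  -- ground states of the sector in `S`-form ↔ `IsGroundStateInSector` (or zero)
  have hconv : ∀ v, v ∈ szSector N 0 → H *ᵥ v = ((H.minEnergyOn (szSector N 0) : ℝ) : ℂ) • v →
      v = 0 ∨ IsGroundStateInSector H N 0 v := fun v hvS hv => by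
    by_cases h0 : v = 0
    · exact Or.inl h0
    · exact Or.inr ⟨hvS, h0, hv⟩
  have hback : ∀ v, (v = 0 ∨ IsGroundStateInSector H N 0 v) →
      v ∈ szSector N 0 ∧ H *ᵥ v = ((H.minEnergyOn (szSector N 0) : ℝ) : ℂ) • v := by
    rintro v (rfl | hv)
    · exact ⟨Submodule.zero_mem _, by rw [mulVec_zero, smul_zero]⟩
    · exact ⟨hv.1, hv.2.2⟩
  have key := groundState_order_of_irreducible H O (szSector N 0) _ (c * ((n + 1 : ℕ) : ℝ) ^ 4) G
    hO
    (fun g hg v hvS hv => by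
      rcases hconv v hvS hv with h0 | h0
      · subst h0
        simp
      · obtain ⟨h1, h2⟩ := hG g hg v h0
        exact ⟨hback _ h1, hback _ h2⟩)
    (fun W hW hWinv => (hirr W (fun w hw => hconv w (hW w hw).1 (hW w hw).2) hWinv).imp_right
      fun hall v hvS hv => by
        rcases hconv v hvS hv with h0 | h0
        · rw [h0]; exact W.zero_mem
        · exact hall v h0)
    ⟨ψ, hψ.1, hψ.2.2, hψ1, hψc⟩
  have hφ := key φ hgs.1 hgs.2.2
  rw [hφ1, Complex.one_re, mul_one] at hφ
  exact hφ

end Summit.HubbardSuperconductivity.HubbardSuperconductivity.Theorems
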